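import Literature.Algebra.Lie.GoursatSimpleFactor
import HarnessLib

/-!
# Ribet's lemma for Lie algebras, kernel form: a simple quotient of a subalgebra of `𝔰₁ × ⋯ × 𝔰ₙ` with surjective
# projections factors through ONE projection (Ribet 1976 pp. 790–791; Katz 1990 §1.8, proof of Prop. 1.8.2)

Topic `Literature/Algebra/Lie`, namespace `Literature.Algebra.Lie.RibetLemma`. THEOREMS only, Mathlib vocabulary
(`LieHom`, `LieIdeal`, `LieAlgebra.IsSimple`). Companion of `GoursatSimpleFactor` (the two-factor Goursat lemma).

SETTING (invariant form, as in `GoursatSimpleFactor`): instead of a subalgebra of a product we take a Lie algebra `𝔥`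
with a finite family of Lie homomorphisms `p j : 𝔥 → 𝔰 j` (`j ∈ J`) onto SIMPLE Lie algebras `𝔰 j`, and a surjection
`φ : 𝔥 ↠ 𝔞` onto a SIMPLE `𝔞` which kills the joint kernel `N_J = ⨅_{j ∈ J} ker (p j)` (for a subalgebra
`𝔥 ≤ Π 𝔰 j` the joint kernel is `0` and the condition is empty).

* **`exists_ker_le_ker`** (Ribet's lemma, kernel form) — some single projection already kills `ker φ`'s complement:
  `∃ j ∈ J, ker (p j) ≤ ker φ`.  Proof by induction on `J` using only simplicity (Katz: "a simple Lie algebra lemma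
  [Ri, pp. 790–791] reduces us to the case `n = 2`"): with `J = insert j₁ J'`, the ideal `p_{j₁}(N_{J'})` of the simple
  `𝔰 j₁` is `0` — then `N_{J'} ≤ N_J ≤ ker φ` and the induction hypothesis applies — or everything — then
  `ker p_{j₁} + N_{J'} = 𝔥`, so the ideals `U = φ(ker p_{j₁})`, `W = φ(N_{J'})` of `𝔞` satisfy `U + W = 𝔞` and
  `[U, W] ⊆ φ(ker p_{j₁} ∩ N_{J'}) = φ(N_J) = 0`; `𝔞` being simple and non-abelian, `U = 0` (answer `j₁`) or `W = 0`
  (induction hypothesis).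
* **`exists_bijective_comp_eq`** — consequently `φ = ψ ∘ p j` for a BIJECTIVE Lie homomorphism `ψ : 𝔰 j → 𝔞`
  (`ψ (p j x) := φ x`; injective because its kernel is a proper ideal of the simple `𝔰 j`).

USE (cell `hodge-nonav`, crux K1 of `Summits/HodgeConjecture/HodgeConjecture/Theses/CyclicUnitaryPowers.lean`, roadmap
`memos/GKR-CORE-ROADMAP-Ax-g2.md` step C4): for the Lie algebra `𝔤` of the monodromy closure inside `⊕ᵢ 𝔤𝔩(Eᵢ)` with
`pᵢ(𝔥) = 𝔰𝔩(Eᵢ)`, a vanishing block kernel at `i₀` makes `p_{i₀}` factor through some `p_j`, `j ≠ i₀`, by an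
isomorphism `𝔰𝔩(E_j) ≅ 𝔰𝔩(E_{i₀})` — the input of the `Aut 𝔰𝔩ₙ` step. Written by the prover seat `hodge-nonav-prover-Ax`.

## References
* [Ribet1976RealMultiplications] K. A. Ribet, *Galois action on division points of Abelian varieties with real
  multiplications*, Amer. J. Math. 98 (1976), pp. 790–791 (the lemma on subalgebras of products of simple Lie
  algebras). [cite: Ribet1976RealMultiplications, pp. 790–791]
* [Katz1990ESDE] N. M. Katz, *Exponential Sums and Differential Equations* (1990), §1.8, proof of Prop. 1.8.2.
* [Hazama1983] F. Hazama, Tôhoku Math. J. 35 (1983), Prop. (2.6) (Ribet's lemma), Lemma (3.1).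
-/

namespace Literature.Algebra.Lie.RibetLemma

open LieAlgebra

universe u v w w'

variable {K : Type u} [Field K]
variable {𝔥 : Type v} [LieRing 𝔥] [LieAlgebra K 𝔥]
variable {ι : Type*} {𝔰 : ι → Type w} [∀ j, LieRing (𝔰 j)] [∀ j, LieAlgebra K (𝔰 j)] [∀ j, IsSimple K (𝔰 j)]
variable {𝔞 : Type w'} [LieRing 𝔞] [LieAlgebra K 𝔞] [IsSimple K 𝔞]

/-- In a simple Lie algebra two ideals with `U ⊔ W = ⊤` and `⁅U, W⁆ = ⊥` cannot both be non-zero (else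
`⁅⊤, ⊤⁆ = 0` and the algebra would be abelian). [cite: Katz1990ESDE, §1.8 Prop. 1.8.2 (proof)] -/
theorem eq_bot_or_eq_bot_of_sup_eq_top_of_lie_eq_bot (U W : LieIdeal K 𝔞) (hsup : U ⊔ W = ⊤) (hlie : ⁅U, W⁆ = ⊥) :
    U = ⊥ ∨ W = ⊥ := by
  rcases IsSimple.eq_bot_or_eq_top U with hU | hU
  · exact Or.inl hU
  rcases IsSimple.eq_bot_or_eq_top W with hW | hW
  · exact Or.inr hW
  exfalso
  subst hU; subst hW
  refine IsSimple.non_abelian K (L := 𝔞) ⟨fun x y => ?_⟩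
  rw [LieSubmodule.lie_eq_bot_iff] at hlie
  exact hlie x (LieSubmodule.mem_top x) y (LieSubmodule.mem_top y)

omit [∀ j, IsSimple K (𝔰 j)] in
/-- The joint kernel `N_J = ⨅_{j ∈ J} ker (p j)`: membership. [cite: Katz1990ESDE, §1.8 Prop. 1.8.2 (proof)] -/
theorem mem_iInf_ker_iff (p : ∀ j, 𝔥 →ₗ⁅K⁆ 𝔰 j) (J : Finset ι) (x : 𝔥) :
    x ∈ (⨅ j ∈ J, (p j).ker : LieIdeal K 𝔥) ↔ ∀ j ∈ J, p j x = 0 := by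
  simp only [LieSubmodule.mem_iInf, LieHom.mem_ker]

/-- **Ribet's lemma (kernel form).** Let `p j : 𝔥 ↠ 𝔰 j` (`j ∈ J`, `J` finite) be surjective Lie homomorphisms onto
simple Lie algebras and `φ : 𝔥 ↠ 𝔞` a surjection onto a simple Lie algebra with `⨅_{j∈J} ker (p j) ≤ ker φ`. Then
`ker (p j) ≤ ker φ` for some `j ∈ J` — `φ` factors through a single projection.
[cite: Ribet1976RealMultiplications, pp. 790–791] [cite: Katz1990ESDE, §1.8 Prop. 1.8.2 (proof)] -/
theorem exists_ker_le_ker (p : ∀ j, 𝔥 →ₗ⁅K⁆ 𝔰 j) (φ : 𝔥 →ₗ⁅K⁆ 𝔞) (hφ : Function.Surjective φ) (J : Finset ι)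
    (hp : ∀ j ∈ J, Function.Surjective (p j)) (hN : (⨅ j ∈ J, (p j).ker : LieIdeal K 𝔥) ≤ φ.ker) :
    ∃ j ∈ J, (p j).ker ≤ φ.ker := by
  classical
  induction J using Finset.induction_on with
  | empty =>
    -- `N_∅ = ⊤ ≤ ker φ`: `φ = 0`, impossible for a surjection onto a simple (non-abelian) algebra
    exfalso
    have htop : (⊤ : LieIdeal K 𝔥) ≤ φ.ker := by
      intro x _
      exact hN ((mem_iInf_ker_iff p ∅ x).2 fun j hj => absurd hj (Finset.notMem_empty j))
    refine IsSimple.non_abelian K (L := 𝔞) ⟨fun a b => ?_⟩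
    obtain ⟨x, rfl⟩ := hφ a
    have hx : φ x = 0 := LieHom.mem_ker.1 (htop (LieSubmodule.mem_top x))
    rw [hx, zero_lie]
  | insert j₁ J' hj₁ ih =>
    -- the ideal `p_{j₁}(N_{J'})` of the simple `𝔰 j₁`
    set N' : LieIdeal K 𝔥 := ⨅ j ∈ J', (p j).ker with hN'def
    have hpj₁ : Function.Surjective (p j₁) := hp j₁ (Finset.mem_insert_self j₁ J')
    have hp' : ∀ j ∈ J', Function.Surjective (p j) := fun j hj => hp j (Finset.mem_insert_of_mem hj)
    -- `N_J = ker p_{j₁} ⊓ N_{J'}`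
    have hNJ : (p j₁).ker ⊓ N' ≤ φ.ker := by
      intro x hx
      rw [LieSubmodule.mem_inf, LieHom.mem_ker] at hx
      refine hN ((mem_iInf_ker_iff p _ x).2 fun j hj => ?_)
      rcases Finset.mem_insert.1 hj with rfl | hj
      · exact hx.1
      · exact (mem_iInf_ker_iff p J' x).1 hx.2 j hj
    have hIH : N' ≤ φ.ker → ∃ j ∈ insert j₁ J', (p j).ker ≤ φ.ker := fun h => by
      obtain ⟨j, hj, hjk⟩ := ih hp' h
      exact ⟨j, Finset.mem_insert_of_mem hj, hjk⟩
    rcases IsSimple.eq_bot_or_eq_top (N'.map (p j₁)) with h0 | h1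
    · -- `p_{j₁}(N_{J'}) = 0`: `N_{J'} ≤ ker p_{j₁}`, so `N_{J'} = N_J ≤ ker φ`
      rw [LieIdeal.map_eq_bot_iff] at h0
      exact hIH fun x hx => hNJ ((LieSubmodule.mem_inf _ _ _).2 ⟨h0 hx, hx⟩)
    · -- `p_{j₁}(N_{J'}) = 𝔰 j₁`: `ker p_{j₁} ⊔ N_{J'} = ⊤`
      have hsup : (p j₁).ker ⊔ N' = ⊤ := by
        rw [eq_top_iff]
        intro x _
        obtain ⟨⟨n, hn⟩, hnx⟩ := LieIdeal.mem_map_of_surjective hpj₁ (h1 ▸ LieSubmodule.mem_top (p j₁ x))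
        rw [LieSubmodule.mem_sup]
        refine ⟨x - n, ?_, n, hn, sub_add_cancel x n⟩
        rw [LieHom.mem_ker, map_sub, ← hnx, sub_self]
      -- the ideals `U = φ(ker p_{j₁})`, `W = φ(N_{J'})` of `𝔞`
      have hUW : ((p j₁).ker).map φ ⊔ N'.map φ = ⊤ := by
        rw [← LieIdeal.map_sup, hsup, ← LieHom.idealRange_eq_map, φ.idealRange_eq_top_of_surjective hφ]
      have hlie : ⁅((p j₁).ker).map φ, N'.map φ⁆ = ⊥ := by
        rw [← LieIdeal.map_bracket_eq φ hφ, LieIdeal.map_eq_bot_iff]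
        exact (LieSubmodule.lie_le_inf _ _).trans hNJ
      rcases eq_bot_or_eq_bot_of_sup_eq_top_of_lie_eq_bot _ _ hUW hlie with hU | hW
      · rw [LieIdeal.map_eq_bot_iff] at hU
        exact ⟨j₁, Finset.mem_insert_self j₁ J', hU⟩
      · rw [LieIdeal.map_eq_bot_iff] at hW
        exact hIH hW

/-- **Ribet's lemma for subalgebras of a product** (the usual form): if the `p j`, `j ∈ J`, are JOINTLY INJECTIVE on
`𝔥` (`𝔥 ↪ Π_{j∈J} 𝔰 j`) and surjective onto the simple `𝔰 j`, then every surjection `φ : 𝔥 ↠ 𝔞` onto a simple Lie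
algebra satisfies `ker (p j) ≤ ker φ` for some `j ∈ J`. [cite: Ribet1976RealMultiplications, pp. 790–791]
[cite: Hazama1983, Prop. (2.6)] -/
theorem exists_ker_le_ker_of_jointly_injective (p : ∀ j, 𝔥 →ₗ⁅K⁆ 𝔰 j) (φ : 𝔥 →ₗ⁅K⁆ 𝔞)
    (hφ : Function.Surjective φ) (J : Finset ι) (hp : ∀ j ∈ J, Function.Surjective (p j))
    (hinj : ∀ x : 𝔥, (∀ j ∈ J, p j x = 0) → x = 0) : ∃ j ∈ J, (p j).ker ≤ φ.ker :=
  exists_ker_le_ker p φ hφ J hp fun x hx => by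
    rw [(hinj x ((mem_iInf_ker_iff p J x).1 hx))]
    exact (φ.ker).zero_mem

/-- **Factorisation through one projection by an isomorphism**: under the hypotheses of `exists_ker_le_ker`, there
are `j ∈ J` and a BIJECTIVE Lie homomorphism `ψ : 𝔰 j → 𝔞` with `φ = ψ ∘ p j` (`ψ (p j x) = φ x`; `ψ` is injective
because its kernel is a proper ideal of the simple `𝔰 j`). In Katz's use: a block projection of the monodromy Lie
algebra is the composite of another block projection with an isomorphism `𝔰𝔩(E_j) ≅ 𝔰𝔩(E_{i₀})`.
[cite: Katz1990ESDE, §1.8 Prop. 1.8.2 (proof)] [cite: Ribet1976RealMultiplications, pp. 790–791] -/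
theorem exists_bijective_comp_eq (p : ∀ j, 𝔥 →ₗ⁅K⁆ 𝔰 j) (φ : 𝔥 →ₗ⁅K⁆ 𝔞) (hφ : Function.Surjective φ)
    (J : Finset ι) (hp : ∀ j ∈ J, Function.Surjective (p j))
    (hN : (⨅ j ∈ J, (p j).ker : LieIdeal K 𝔥) ≤ φ.ker) :
    ∃ j ∈ J, ∃ ψ : 𝔰 j →ₗ⁅K⁆ 𝔞, Function.Bijective ψ ∧ ψ.comp (p j) = φ := by
  obtain ⟨j, hj, hker⟩ := exists_ker_le_ker p φ hφ J hp hN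
  have hpj : Function.Surjective (p j) := hp j hj
  -- the linear factorisation `φ = ψ₀ ∘ p j`
  have hker' : LinearMap.ker ((p j : 𝔥 →ₗ⁅K⁆ 𝔰 j) : 𝔥 →ₗ[K] 𝔰 j) ≤ LinearMap.ker (φ : 𝔥 →ₗ[K] 𝔞) := by
    intro x hx
    rw [LinearMap.mem_ker] at hx ⊢
    exact LieHom.mem_ker.1 (hker (LieHom.mem_ker.2 hx))
  let e : (𝔥 ⧸ LinearMap.ker ((p j : 𝔥 →ₗ⁅K⁆ 𝔰 j) : 𝔥 →ₗ[K] 𝔰 j)) ≃ₗ[K] 𝔰 j :=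
    LinearMap.quotKerEquivOfSurjective _ hpj
  let ψ₀ : 𝔰 j →ₗ[K] 𝔞 := (LinearMap.ker ((p j : 𝔥 →ₗ⁅K⁆ 𝔰 j) : 𝔥 →ₗ[K] 𝔰 j)).liftQ (φ : 𝔥 →ₗ[K] 𝔞) hker' ∘ₗ
    (e.symm : 𝔰 j →ₗ[K] _)
  have hψ₀ : ∀ x : 𝔥, ψ₀ (p j x) = φ x := by
    intro x
    have he : e.symm (p j x) = Submodule.Quotient.mk x := by
      rw [LinearEquiv.symm_apply_eq]
      rfl
    change (LinearMap.ker _).liftQ (φ : 𝔥 →ₗ[K] 𝔞) hker' (e.symm (p j x)) = φ x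
    rw [he, Submodule.liftQ_apply]
    rfl
  -- it is a Lie homomorphism (check on `p j x`, `p j y`)
  let ψ : 𝔰 j →ₗ⁅K⁆ 𝔞 :=
    { ψ₀ with
      map_lie' := by
        intro a b
        obtain ⟨x, rfl⟩ := hpj a
        obtain ⟨y, rfl⟩ := hpj b
        change ψ₀ ⁅p j x, p j y⁆ = ⁅ψ₀ (p j x), ψ₀ (p j y)⁆
        rw [← LieHom.map_lie, hψ₀, hψ₀, hψ₀, LieHom.map_lie] }
  have hψ : ∀ x : 𝔥, ψ (p j x) = φ x := hψ₀
  refine ⟨j, hj, ψ, ⟨?_, ?_⟩, ?_⟩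
  · -- injective: `ker ψ` is an ideal of the simple `𝔰 j`, not `⊤` since `ψ` is onto the non-zero `𝔞`
    rw [← LieHom.ker_eq_bot]
    rcases IsSimple.eq_bot_or_eq_top ψ.ker with h | h
    · exact h
    · exfalso
      refine IsSimple.non_abelian K (L := 𝔞) ⟨fun a b => ?_⟩
      obtain ⟨x, rfl⟩ := hφ a
      have : φ x = 0 := by
        rw [← hψ]
        exact LieHom.mem_ker.1 (h ▸ LieSubmodule.mem_top (p j x))
      rw [this, zero_lie]
  · intro a
    obtain ⟨x, rfl⟩ := hφ a
    exact ⟨p j x, hψ x⟩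
  · ext x
    exact hψ x

/-- **Dichotomy for one factor** (Katz's use of Ribet's lemma): let the `p j : 𝔥 ↠ 𝔰 j` (`j ∈ J`) be surjective onto
simple Lie algebras, and `i₀ ∈ J`. EITHER every element of `𝔰 i₀` lifts to an element of `𝔥`
killed by all the other projections (the "`i₀`-th kernel" of `𝔥` maps ONTO `𝔰 i₀`), OR `p i₀` factors through another
projection by an isomorphism: `p i₀ = ψ ∘ p j` with `j ∈ J`, `j ≠ i₀`, `ψ : 𝔰 j → 𝔰 i₀` bijective. (The image of the
`i₀`-th kernel is an ideal of the simple `𝔰 i₀`; if it vanishes, the other projections are jointly injective and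
`exists_bijective_comp_eq` applies to `φ = p i₀`.) [cite: Katz1990ESDE, §1.8 Prop. 1.8.2 (proof)]
[cite: Ribet1976RealMultiplications, pp. 790–791] -/
theorem forall_exists_lift_or_exists_bijective_comp_eq (p : ∀ j, 𝔥 →ₗ⁅K⁆ 𝔰 j) (J : Finset ι)
    (hp : ∀ j ∈ J, Function.Surjective (p j)) {i₀ : ι} (hi₀ : i₀ ∈ J) :
    (∀ a : 𝔰 i₀, ∃ x : 𝔥, p i₀ x = a ∧ ∀ j ∈ J, j ≠ i₀ → p j x = 0) ∨
      ∃ j ∈ J, j ≠ i₀ ∧ ∃ ψ : 𝔰 j →ₗ⁅K⁆ 𝔰 i₀, Function.Bijective ψ ∧ ψ.comp (p j) = p i₀ := by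
  classical
  -- the `i₀`-th kernel `𝔨 = ⨅_{j ∈ J, j ≠ i₀} ker (p j)` and the ideal `p i₀ (𝔨)` of `𝔰 i₀`
  set 𝔨 : LieIdeal K 𝔥 := ⨅ j ∈ J.erase i₀, (p j).ker with h𝔨
  rcases IsSimple.eq_bot_or_eq_top (𝔨.map (p i₀)) with h0 | h1
  · -- `p i₀ (𝔨) = 0`: the other projections are jointly injective on `𝔥`
    right
    rw [LieIdeal.map_eq_bot_iff] at h0
    have hN : (⨅ j ∈ J.erase i₀, (p j).ker : LieIdeal K 𝔥) ≤ (p i₀).ker := h0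
    obtain ⟨j, hj, ψ, hψ, hcomp⟩ := exists_bijective_comp_eq p (p i₀) (hp i₀ hi₀) (J.erase i₀)
      (fun j hj => hp j (Finset.mem_of_mem_erase hj)) hN
    exact ⟨j, Finset.mem_of_mem_erase hj, Finset.ne_of_mem_erase hj, ψ, hψ, hcomp⟩
  · -- `p i₀ (𝔨) = 𝔰 i₀`: every `a` lifts into `𝔨`
    left
    intro a
    obtain ⟨⟨x, hx⟩, hxa⟩ := LieIdeal.mem_map_of_surjective (hp i₀ hi₀) (h1 ▸ LieSubmodule.mem_top a)
    refine ⟨x, hxa, fun j hj hji => ?_⟩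
    exact (mem_iInf_ker_iff p (J.erase i₀) x).1 hx j (Finset.mem_erase.2 ⟨hji, hj⟩)

end Literature.Algebra.Lie.RibetLemma
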